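import Summits.Schanuel.Schanuel.Theorems.RootDecomp1KHyper13
import Literature.NumberTheory.Transcendental.IntPolyBounds

/-!
# RootDecomp1ELWTransport — lens 2, generation 39 «LW-PAIR NORM TRANSPORT CELL» (lane E-R18 (a)): S ITSELF on the class `InLWClass` (E-doubled moment curves over a dyadic 2-fold-hyper-Liouville T), engine `algebraicIndependent_lwPt` mod `hLW : LWMeasure` — part 1 (RootDecomp1ELWTransport01): §1 dyadic norm descent in ℤ[X,Y]: sign twists, `quad`, evenness (first half)

PORT NOTE (census-1 gen 17, 2026-08-31): port of [HOME/decomp-schanuel-lens-2/g39/LWTransport.lean sha256 cff5d88d…e8f0, 2208 l + LWTransportProbe b425d016… + LWTransportCtrl c06ce7ef… (rc 1 at exactly 5 planted lines) + LWTransportDischarge 640fe910… (hLW discharge, farm-unbuilt) + NODE-g39.md 89517624…; NOTE/CLAIM L1848, critic ACK + CHECKLIST E-g39 L1854, NODE L1907 / REQUEST L1908, critic VERDICT L1909 (CLEARED · E-R18 (a) CELL CREDIT AWARDED to lens-2 — «S ITSELF on the 1E class InLWClass (every n), first S-itself cell of 1E with a transcendental scale, explicit n = 4 E-stable member z₄»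 · LABEL k = 1 KNOWN / k ≥ 2 VARIANT-REACH pending acq-15029 · PORT GO)]; own farm rc 0 · 0 warn · 0 sorry · axioms std.
Split in nine parts for the 400-line cap, ONE-ENGINE modules with NO 1E vocabulary (critic L1854 PORT shape; the lens's plan NODE-g39 §7): 01 = §1 dyadic norm descent in ℤ[X,Y] (sign twists `sgn`, `quad`, evenness/`halve` — first half); 02 = §1 (halving, one step `step`, the iteration `descend`, `aeval_step`, `norm_aeval_descend_le`); 03 = §2 the collapse at a dyadic approximant (`lwPt`, blocks/weights, `Apoly`, `Apoly_ne_zero`, `FL`); 04 = §3 `DyadicHyper₂`, `endgame_lw`, bookkeeping lemmas; 05 = §3 THE TRANSPORT THEOREM `algebraicIndependent_lwPt` (kernel, `maxHeartbeats 1600000 in` carried); 06 = §3b the descent identity + §4 the explicit member `Tstar` (`dyadicHyper₂_Tstar`, `Tstar_transcendental`); 07 = §5 the class `InLWClass`, `schanuel_on_lwClass`, the CELLS `cell_25020` / `cell_31409` / `cell_31410` (binders verbatim + ONE class line, no Theses vocabulary), the credit member `zStar` (`four_le_trdeg_zStar`, `item31409_at_zStar`) + §5b the member family `zTwin` (`schanuel_zTwin`);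 08 = §6–§6b SEPARATION (`not_inScaleClass_zStar`, `not_inPointClass_zStar`, `not_coveredTower_Tstar`, `not_inTwoScaleClass_zStar`); 09 = §7 CONTROLS (proved negatives) + §8 PORT ADDITION: the LIVE read-outs `defectOneSchanuel_iff` / `eStableDefectOne_iff` / `plainDefectOne_iff` (`Iff.rfl`, probe P1–P3) + `cell_25020_of_defectOneSchanuel` + §9 PORT ADDITION (VERDICT L1909 (f)): `Iff.rfl` bridges `Sep.inScaleClass_iff` / `Sep.inPointClass_iff` / `Sep.coveredTower_iff` / `Sep.inTwoScaleClass_iff` to the TREE classes of `RootDecomp1EScaleTransfer03` / `RootDecomp1EPointTransfer03` / `RootDecomp1ETwoScale02`/`08` and the separation restated against them (`…_tree`) — the ONLY part importing `Theses.RootDecomp1E` (it arrives with the tree `RootDecomp1ETwoScale08`).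
PORT EDITS: `import Summits.Schanuel.Schanuel.Theses.RootDecomp1E`, the `open … (DefectOneSchanuel …)` line and `defectOneSchanuel_iff` REMOVED from the engine/cell parts (moved to part 09, so that no engine/cell/separation part carries the route-file cone); `import HarnessLib` dropped (unused); `set_option linter.dupNamespace false` / `linter.unusedSectionVars false` dropped; 98 one-line docstrings added (statement read-outs); generic one-liners `le_exp_self`, `pow_le_exp_mul`, `apply_le_totalDegree`, `abs_coeff_le_zlen`, `one_le_zlen'`, `isAlgebraic_I`, `I_not_mem_range`, `forall_fin_four`, `ne_of_not_mem_range`, `isAlgebraic_intCombination`, `four_mul_succ_le_two_pow`, `eight_pow_four_le`, `key_nat`, `prod_pow_cexp` made private (+ per-part private copies); statements and proofs otherwise verbatim; `hLW : LWMeasure` stays a binder BY NAME (= the tree theorem `Ably1994_lindemannWeierstrass_measure_holds`; the lens's one-line discharge LWTransportDischarge.lean waits for the farm to build `QuantitativeCIAPolynomial`). `--supports stmt-Schanuel-31409`; no census credit carried; nothing here proves Schanuel or the 1E items; rung 0. The lens's header follows.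
-/

/-!
# LW-PAIR NORM TRANSPORT CELL
(decomp-schanuel · lens 2 «structural dichotomy (special vs generic)» · generation 39 · kernel file
`LWTransport.lean`; companions `LWTransportProbe.lean`, `LWTransportCtrl.lean`, `LWTransportDischarge.lean`)

Node file for `route-Schanuel-RootDecomp1E` (DRAFT rev 25), lane E-R18 (a): `S` ITSELF (Schanuel's bound —
not the defect-one surrogate) on an explicit, Lebesgue-null class of E-stable tuples of every EVEN length
`n = 2k`, and the induced CELLS of the live items stmt-Schanuel-25020 `DefectOneSchanuel`,
stmt-Schanuel-31409 `EStableDefectOne`, stmt-Schanuel-31410 `PlainDefectOne` (binders verbatim, one class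
line, one-line proofs from `S` on the class).

THE CLASS `InLWClass z` (§5): `Set.range z ⊆ {T^j, βT^j : 1 ≤ j ≤ k}` for a real `T > 0` that is DYADIC
2-FOLD HYPER-LIOUVILLE (`DyadicHyper₂ T`: for every `m` a dyadic `p/2^μ`, `μ ≥ m`, with
`0 < |T − p/2^μ| < exp(−exp(2^{mμ}))`) and an algebraic irrational `β`.

THE ENGINE (§1–§3, `algebraicIndependent_lwPt`, hypothesis-free in `k`, `β`, `T`): for such `T, β` and
every `k` the `2k+1` numbers `T, e^{T}, …, e^{T^k}, e^{βT}, …, e^{βT^k}` are algebraically independent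
over `ℚ` — mod the single binder `(hLW : LWMeasure)` = Ably's 1994 Lindemann–Weierstrass measure
(`RootDecomp1KHyper04`, character-identical to the Literature fact `Ably1994_lindemannWeierstrass_measure`,
PROVED in the tree as `Ably1994_lindemannWeierstrass_measure_holds`; carried by name exactly as the tree
files `RootDecomp1KHyper04/18/20/52` do).  Mechanism: a relation `P(T, e^{T^j}, e^{βT^j}) = 0`, `P ≠ 0`, is
specialised at a dyadic approximant `p/Q`, `Q = 2^μ`; there ALL `2k` exponentials COLLAPSE onto the pair
`u = e^{1/Q^k}`, `v = e^{β/Q^k}` (`e^{(p/Q)^j} = u^{p^j Q^{k−j}}`), giving `A(u,v)`, `A ∈ ℤ[U,V]` NON-ZERO by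
base-`p` weight injectivity (§2 `Apoly_ne_zero`) with degree `≤ deg P · k p^k` and controlled length;
the DYADIC NORM DESCENT (§1: `f ↦ f(X,Y) f(−X,Y) f(X,−Y) f(−X,−Y)`, then `X², Y² ↦ X, Y`), iterated `kμ`
times, transports `A(u,v)` to a non-zero INTEGER polynomial value `B(e, e^β)` with an explicit upper
bound in terms of `|A(u,v)|`; Ably's measure at the FIXED pair `(e, e^β)` bounds `|B(e, e^β)|` below by a
double exponential in the degree, and the 2-fold-hyper approximation beats it (§3 `endgame_lw`).  No
Galois theory, no roots of unity: the norm is computed integrally by sign twists.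

MEMBERS (§4, §5, §5b): `T⋆ = Σ_ν 2^{−a_ν}` (`a_0 = 1`, `a_{ν+1} = a_ν + 1 + 2·3^{2^{ν a_ν}}`) is PROVED
dyadic 2-fold hyper-Liouville, irrational, transcendental; the credit member `z₄ = (T⋆, iT⋆, T⋆², iT⋆²)`
(n = 4) is ℚ-free, E-stable (`β = i`, binder of 31409 MET), in the class, and `S` holds at it
(`four_le_trdeg_zStar`; item 31409 applied: `item31409_at_zStar`); the whole family
`zTwin k β T = (T, …, T^k, βT, …, βT^k)` gets `S` at length `2k` for every `k`, every algebraic irrational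
`β` and every `T` of the class (`schanuel_zTwin`, `schanuel_zTwin_of_dyadicHyper₂`; F2 table
n = 4, 6, 8, …; the tree decides tuples of this kind only for n ≤ 3).

SEPARATION (§6, §6b, typed against verbatim copies of the g35/g36/g37 predicates): `z₄` lies in none of
g35 `InScaleClass`, g36 `InPointClass` (there all coordinate ratios are algebraic; here `z₄ 2 / z₄ 0 = T⋆`
is transcendental) and g37 `InTwoScaleClass` (its first scale must be a COVERED log-cube tower; the
lacunary `T⋆` is not: `not_coveredTower_Tstar`).  g38 `InGenericScaleClass` is typed through a
non-computable relation-type function and is not compared (no claim).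

CONTROLS (§7, PROVED negatives; `LWTransportCtrl.lean` = this file + 5 planted failures, rc 1 with
exactly 5 errors): `β ∈ ℚ` ⇒ the tuple is algebraically DEPENDENT; a 1-fold hyper-Liouville budget
`exp(−q^m)` is met by numbers the endgame must exclude; no fifth coordinate can be adjoined at `z₄`;
`hLW` and dyadicity are load-bearing.  `LWTransportProbe.lean` = this file + read-backs of `S`, 25020,
31409, 31410 BY NAME (`Iff.rfl`) + 29 `#guard_msgs` axiom guards (standard axioms only).

SCOPE (honest): the class is explicit and Lebesgue-null; nothing here moves the wall (c⁗) for `T`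
outside the 2-fold-hyper classes; NO novelty is claimed for `n ≤ 3` (every ℚ-free triple in the class
has an HL line pair already decided in the tree mod NW96).  PLACEMENT (NODE-g39.md §6): the abstract
approximation criterion is Waldschmidt–Zhu 1990 (Zhu, 超越數: 代數無關性, Lemma 1.2.1 / Cor. 1.2.2);
the `k = 1` tuple `(T, e^T, e^{βT})` is Galochkin 1970 / Väänänen 1976–77 in print (Waldschmidt's 1990
survey, LNM 1415); no source found covering `(T, e^{T^j}, e^{βT^j})_{j ≤ k}`, `k ≥ 2` (acq-15029, Zhu
2006 Acta Math. Sin., pending).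

## References
* [Ably1994] M. Ably, Une version quantitative du théorème de Lindemann–Weierstrass, Acta Arith. 67
  (1994) 29–45 — tree theorem `Ably1994_lindemannWeierstrass_measure_holds`.
* [WaldschmidtZhu1990] M. Waldschmidt, Zhu Yaochen, Algebraic independence of numbers related to
  Liouville numbers, Sci. China Ser. A 33 (1990) 258–268.
* [Waldschmidt1990] M. Waldschmidt, Indépendance algébrique de nombres de Liouville, in: Cinquante ans
  de polynômes, LNM 1415 (1990) 225–235.
* [Vaananen1976] K. Väänänen, On the arithmetic properties of certain values of the exponential
  function, Studia Sci. Math. Hungar. 11 (1976) 399–405.  [Galochkin1970] A. I. Galochkin (1970).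
-/

noncomputable section

open Complex Polynomial
open Literature.NumberTheory.Transcendental (zlen zlen_nonneg zlen_add_le zlen_monomial_le zlen_sum_le
  zlen_mul_le zlen_pow_le)

namespace Summit.Schanuel.Schanuel.Theorems.RootDecomp1ELWTransport

/-! ## §1  Dyadic norm descent in `ℤ[X, Y]`

For `f ∈ ℤ[X,Y]` put `quad f := f(X,Y)·f(−X,Y)·f(X,−Y)·f(−X,−Y)`; it is even in `X` and in `Y`, so
`quad f = g(X², Y²)` for a unique `g =: step f ∈ ℤ[X,Y]` (halve the exponents).  Iterating `m` times gives
`descend m f ∈ ℤ[X,Y]` with `descend m f (x^{2^m}, y^{2^m}) = ∏_{ζ^{2^m} = 1, ξ^{2^m} = 1} f(ζx, ξy)` — the norm of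
`f` from `ℚ(x,y)` down to `ℚ(x^{2^m}, y^{2^m})`, computed INTEGRALLY (no roots of unity, no Galois theory).
We only need: `descend m f ≠ 0`, `deg ≤ 2^m deg f`, `length ≤ length(f)^{4^m}`, and the upper bound
`|descend m f (x^{2^m}, y^{2^m})| ≤ |f(x,y)| · length(f)^{4^m} · R^{3·2^m·deg f}` (`R ≥ |x|^{2^j}, |y|^{2^j}`). -/
namespace NormDescent

/-- `ℤ[X, Y]`. -/
abbrev P2 : Type := MvPolynomial (Fin 2) ℤ

/-- The sign substitution `Xᵢ ↦ εᵢ Xᵢ`. -/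
def sgn (ε : Fin 2 → ℤ) : P2 →ₐ[ℤ] P2 :=
  MvPolynomial.aeval fun i => MvPolynomial.C (ε i) * MvPolynomial.X i

/-- `sgn ε (MvPolynomial.X i) = MvPolynomial.C (ε i) * MvPolynomial.X i` (for `(ε : Fin 2 → ℤ) (i : Fin 2)`). -/
theorem sgn_X (ε : Fin 2 → ℤ) (i : Fin 2) :
    sgn ε (MvPolynomial.X i) = MvPolynomial.C (ε i) * MvPolynomial.X i := by
  simp [sgn]

/-- `sgn ε (MvPolynomial.monomial m c) = MvPolynomial.monomial m ((∏ i, ε i ^ m i) * c)` (for `(ε : Fin 2 → ℤ) (m : Fin 2 →₀ ℕ) (c : ℤ)`). -/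
theorem sgn_monomial (ε : Fin 2 → ℤ) (m : Fin 2 →₀ ℕ) (c : ℤ) :
    sgn ε (MvPolynomial.monomial m c) = MvPolynomial.monomial m ((∏ i, ε i ^ m i) * c) := by
  unfold sgn
  rw [MvPolynomial.aeval_monomial, eq_intCast, Finsupp.prod_fintype _ _ (fun i => by simp),
    MvPolynomial.monomial_eq, eq_intCast, Finsupp.prod_fintype _ _ (fun i => by simp),
    Fin.prod_univ_two, Fin.prod_univ_two, Fin.prod_univ_two]
  simp only [eq_intCast, mul_pow]
  push_cast
  ring

/-- `(sgn ε f).coeff m = (∏ i, ε i ^ m i) * f.coeff m` (for `(ε : Fin 2 → ℤ) (f : P2) (m : Fin 2 →₀ ℕ)`). -/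
theorem coeff_sgn (ε : Fin 2 → ℤ) (f : P2) (m : Fin 2 →₀ ℕ) :
    (sgn ε f).coeff m = (∏ i, ε i ^ m i) * f.coeff m := by
  induction f using MvPolynomial.induction_on' with
  | monomial m' c =>
    rw [sgn_monomial, MvPolynomial.coeff_monomial, MvPolynomial.coeff_monomial]
    split_ifs with h
    · rw [h]
    · rw [mul_zero]
  | add p q hp hq => rw [map_add, MvPolynomial.coeff_add, MvPolynomial.coeff_add, hp, hq, mul_add]

/-- `sgn ε (sgn ε' f) = sgn (fun i => ε i * ε' i) f` (for `(ε ε' : Fin 2 → ℤ) (f : P2)`). -/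
theorem sgn_sgn (ε ε' : Fin 2 → ℤ) (f : P2) : sgn ε (sgn ε' f) = sgn (fun i => ε i * ε' i) f := by
  have h : (sgn ε).comp (sgn ε') = sgn (fun i => ε i * ε' i) := by
    refine MvPolynomial.algHom_ext fun i => ?_
    rw [AlgHom.comp_apply, sgn_X, sgn_X, map_mul, MvPolynomial.algHom_C, sgn_X]
    simp only [eq_intCast]
    push_cast
    ring
  rw [← AlgHom.comp_apply, h]

/-- `sgn (fun _ => 1) f = f` (for `(f : P2)`). -/
theorem sgn_one (f : P2) : sgn (fun _ => 1) f = f := by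
  have h : sgn (fun _ => (1 : ℤ)) = AlgHom.id ℤ P2 := by
    refine MvPolynomial.algHom_ext fun i => ?_
    rw [sgn_X]; simp
  rw [h]; rfl

/-- `sgn ε f ≠ 0` (for `{ε : Fin 2 → ℤ} (hε : ∀ i, ε i * ε i = 1) {f : P2} (hf : f ≠ 0)`). -/
theorem sgn_ne_zero {ε : Fin 2 → ℤ} (hε : ∀ i, ε i * ε i = 1) {f : P2} (hf : f ≠ 0) : sgn ε f ≠ 0 := by
  intro h0
  have h1 : sgn ε (sgn ε f) = f := by
    rw [sgn_sgn]
    rw [show (fun i => ε i * ε i) = fun _ => (1 : ℤ) from funext hε]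
    exact sgn_one f
  rw [h0, map_zero] at h1
  exact hf h1.symm

/-- `(sgn ε f).support ⊆ f.support` (for `(ε : Fin 2 → ℤ) (f : P2)`). -/
theorem support_sgn_subset (ε : Fin 2 → ℤ) (f : P2) : (sgn ε f).support ⊆ f.support := by
  intro m hm
  rw [MvPolynomial.mem_support_iff] at hm ⊢
  rw [coeff_sgn] at hm
  intro h0; exact hm (by rw [h0, mul_zero])

/-- `(sgn ε f).totalDegree ≤ f.totalDegree` (for `(ε : Fin 2 → ℤ) (f : P2)`). -/
theorem totalDegree_sgn_le (ε : Fin 2 → ℤ) (f : P2) : (sgn ε f).totalDegree ≤ f.totalDegree :=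
  Finset.sup_mono (support_sgn_subset ε f)

/-- `zlen (sgn ε f) ≤ zlen f` (for `{ε : Fin 2 → ℤ} (hε : ∀ i, |ε i| = 1) (f : P2)`). -/
theorem zlen_sgn_le {ε : Fin 2 → ℤ} (hε : ∀ i, |ε i| = 1) (f : P2) : zlen (sgn ε f) ≤ zlen f := by
  rw [zlen, zlen]
  calc ∑ s ∈ (sgn ε f).support, |(((sgn ε f).coeff s : ℤ) : ℝ)|
      ≤ ∑ s ∈ f.support, |(((sgn ε f).coeff s : ℤ) : ℝ)| :=
        Finset.sum_le_sum_of_subset_of_nonneg (support_sgn_subset ε f) fun _ _ _ => abs_nonneg _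
    _ = ∑ s ∈ f.support, |((f.coeff s : ℤ) : ℝ)| := by
        refine Finset.sum_congr rfl fun s _ => ?_
        rw [coeff_sgn, Int.cast_mul, abs_mul]
        have h1 : |((∏ i, ε i ^ s i : ℤ) : ℝ)| = 1 := by
          rw [Int.cast_prod, Finset.abs_prod]
          refine Finset.prod_eq_one fun i _ => ?_
          rw [Int.cast_pow, abs_pow]
          have : |((ε i : ℤ) : ℝ)| = 1 := by exact_mod_cast hε i
          rw [this, one_pow]
        rw [h1, one_mul]

/-- Evaluation of a sign-substituted polynomial. -/
theorem aeval_sgn (ε : Fin 2 → ℤ) (f : P2) (w : Fin 2 → ℂ) :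
    MvPolynomial.aeval w (sgn ε f) = MvPolynomial.aeval (fun i => (ε i : ℂ) * w i) f := by
  unfold sgn
  rw [← AlgHom.comp_apply]
  have h : ((MvPolynomial.aeval w).restrictScalars ℤ).comp
      (MvPolynomial.aeval fun i => MvPolynomial.C (ε i) * MvPolynomial.X i) =
      (MvPolynomial.aeval fun i => (ε i : ℂ) * w i).restrictScalars ℤ := by
    refine MvPolynomial.algHom_ext fun i => ?_
    simp
  have := congrArg (fun φ => φ f) h
  simpa using this

/-! ### the three non-trivial sign vectors -/

/-- The sign vector `(−1, 1)`. -/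
def e10 : Fin 2 → ℤ := ![-1, 1]
/-- The sign vector `(1, −1)`. -/
def e01 : Fin 2 → ℤ := ![1, -1]
/-- The sign vector `(−1, −1)`. -/
def e11 : Fin 2 → ℤ := ![-1, -1]

/-- `quad f = f(X,Y) f(−X,Y) f(X,−Y) f(−X,−Y)`. -/
def quad (f : P2) : P2 := f * sgn e10 f * sgn e01 f * sgn e11 f

/-- `e10 · e10 = 1` componentwise. -/
private theorem e10_sq : (fun i => e10 i * e10 i) = fun _ => (1 : ℤ) := by
  funext i; fin_cases i <;> rfl
/-- `e01 · e01 = 1` componentwise. -/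
private theorem e01_sq : (fun i => e01 i * e01 i) = fun _ => (1 : ℤ) := by
  funext i; fin_cases i <;> rfl
/-- `e11 · e11 = 1` componentwise. -/
private theorem e11_sq : (fun i => e11 i * e11 i) = fun _ => (1 : ℤ) := by
  funext i; fin_cases i <;> rfl
/-- `e10 · e01 = e11`. -/
private theorem e10_e01 : (fun i => e10 i * e01 i) = e11 := by
  funext i; fin_cases i <;> rfl
/-- `e10 · e11 = e01`. -/
private theorem e10_e11 : (fun i => e10 i * e11 i) = e01 := by
  funext i; fin_cases i <;> rfl
/-- `e01 · e10 = e11`. -/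
private theorem e01_e10 : (fun i => e01 i * e10 i) = e11 := by
  funext i; fin_cases i <;> rfl
/-- `e01 · e11 = e10`. -/
private theorem e01_e11 : (fun i => e01 i * e11 i) = e10 := by
  funext i; fin_cases i <;> rfl

/-- `sgn e10 (quad f) = quad f` (for `(f : P2)`). -/
theorem sgn_e10_quad (f : P2) : sgn e10 (quad f) = quad f := by
  unfold quad
  rw [map_mul, map_mul, map_mul, sgn_sgn, sgn_sgn, sgn_sgn, e10_sq, sgn_one, e10_e01, e10_e11]
  ring

/-- `sgn e01 (quad f) = quad f` (for `(f : P2)`). -/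
theorem sgn_e01_quad (f : P2) : sgn e01 (quad f) = quad f := by
  unfold quad
  rw [map_mul, map_mul, map_mul, sgn_sgn, sgn_sgn, sgn_sgn, e01_e10, e01_sq, sgn_one, e01_e11]
  ring

/-- `quad f ≠ 0` (for `{f : P2} (hf : f ≠ 0)`). -/
theorem quad_ne_zero {f : P2} (hf : f ≠ 0) : quad f ≠ 0 := by
  unfold quad
  refine mul_ne_zero (mul_ne_zero (mul_ne_zero hf ?_) ?_) ?_
  · exact sgn_ne_zero (fun i => by fin_cases i <;> rfl) hf
  · exact sgn_ne_zero (fun i => by fin_cases i <;> rfl) hf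
  · exact sgn_ne_zero (fun i => by fin_cases i <;> rfl) hf

/-- `(quad f).totalDegree ≤ 4 * f.totalDegree` (for `(f : P2)`). -/
theorem totalDegree_quad_le (f : P2) : (quad f).totalDegree ≤ 4 * f.totalDegree := by
  unfold quad
  calc (f * sgn e10 f * sgn e01 f * sgn e11 f).totalDegree
      ≤ (f * sgn e10 f * sgn e01 f).totalDegree + (sgn e11 f).totalDegree := MvPolynomial.totalDegree_mul _ _
    _ ≤ ((f * sgn e10 f).totalDegree + (sgn e01 f).totalDegree) + (sgn e11 f).totalDegree := by
        gcongr; exact MvPolynomial.totalDegree_mul _ _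
    _ ≤ ((f.totalDegree + (sgn e10 f).totalDegree) + (sgn e01 f).totalDegree) +
          (sgn e11 f).totalDegree := by
        gcongr; exact MvPolynomial.totalDegree_mul _ _
    _ ≤ ((f.totalDegree + f.totalDegree) + f.totalDegree) + f.totalDegree := by
        gcongr <;> exact totalDegree_sgn_le _ _
    _ = 4 * f.totalDegree := by ring

/-- `1 ≤ zlen f` (for `{f : P2} (hf : f ≠ 0)`). -/
theorem one_le_zlen {f : P2} (hf : f ≠ 0) : 1 ≤ zlen f := by
  obtain ⟨m, hm⟩ := MvPolynomial.ne_zero_iff.mp hf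
  have hmem : m ∈ f.support := MvPolynomial.mem_support_iff.mpr hm
  rw [zlen]
  calc (1 : ℝ) ≤ |((f.coeff m : ℤ) : ℝ)| := by exact_mod_cast Int.one_le_abs hm
    _ ≤ ∑ s ∈ f.support, |((f.coeff s : ℤ) : ℝ)| :=
        Finset.single_le_sum (f := fun s => |((f.coeff s : ℤ) : ℝ)|) (fun _ _ => abs_nonneg _) hmem

/-- `zlen (quad f) ≤ zlen f ^ 4` (for `(f : P2)`). -/
theorem zlen_quad_le (f : P2) : zlen (quad f) ≤ zlen f ^ 4 := by
  have h0 := zlen_nonneg f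
  have h10 : zlen (sgn e10 f) ≤ zlen f := zlen_sgn_le (fun i => by fin_cases i <;> rfl) f
  have h01 : zlen (sgn e01 f) ≤ zlen f := zlen_sgn_le (fun i => by fin_cases i <;> rfl) f
  have h11 : zlen (sgn e11 f) ≤ zlen f := zlen_sgn_le (fun i => by fin_cases i <;> rfl) f
  unfold quad
  have h1 : zlen (f * sgn e10 f) ≤ zlen f * zlen f :=
    (zlen_mul_le _ _).trans (mul_le_mul_of_nonneg_left h10 h0)
  have h2 : zlen (f * sgn e10 f * sgn e01 f) ≤ zlen f * zlen f * zlen f :=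
    (zlen_mul_le _ _).trans (mul_le_mul h1 h01 (zlen_nonneg _) (mul_nonneg h0 h0))
  have h3 : zlen (f * sgn e10 f * sgn e01 f * sgn e11 f) ≤ zlen f * zlen f * zlen f * zlen f :=
    (zlen_mul_le _ _).trans (mul_le_mul h2 h11 (zlen_nonneg _) (mul_nonneg (mul_nonneg h0 h0) h0))
  calc zlen (f * sgn e10 f * sgn e01 f * sgn e11 f) ≤ zlen f * zlen f * zlen f * zlen f := h3
    _ = zlen f ^ 4 := by ring

end NormDescent

end Summit.Schanuel.Schanuel.Theorems.RootDecomp1ELWTransport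

end
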